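import Literature.NumberTheory.NumberFields.QuadraticRamifiedAtOddValuationPlace   -- ★ (Q4-ram): `smul_placesOver_eq_of_subsingleton`, `algEquiv_ne_one_of_apply_eq_neg` (+ ★ (Q3), (QM), (QP), (Q2))
import Literature.NumberTheory.Automorphic.StrongApproximationSArithmetic            -- ★ `denseRange_algebraMap_sInteger_pi`, `mem_integer_iff_forall_coe_mem_adicCompletionIntegers`
import Mathlib.RingTheory.DedekindDomain.Different
import Mathlib.Algebra.Algebra.Subalgebra.IsSimpleOrder
import HarnessLib

/-!
# A QUADRATIC FIELD `E = F(√m₀)` WITH `m₀` A `v`-UNIT IS UNRAMIFIED AT `v ∤ 2`; IF `m₀` IS A LOCAL NON-SQUARE, `v` IS INERT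
# («K₁ AS A COMPLETION», unramified half: the dictionary from «unit square class» to the tree's inert-place currency `(hc, hv, hw)`)

Topic `NumberTheory/NumberFields`; namespace `Literature.NumberTheory.NumberFields`.  THEOREMS ONLY (no definition, no instance, no notation, no named fact,
no `sorry`).  Cell `pub/hodgecm-mathlib` (D-0151), crux H413 = `stmt-HodgeConjecture-24833` (`--supports`), infrastructure organ «LQC — K₁ AS A COMPLETION» (A-80 (2);
SEATCLOSE f24dca57 §4 (i) «P-2 ⟵ LQC Q1∕Q4»), twin of ★ `QuadraticRamifiedAtOddValuationPlace` (the ramified half).  HONEST LABEL: HC_CM is proved only modulo the printed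
citations (hLiu418, h413) until rung 0 closes; this file is unconditional algebraic number theory.

WHAT THIS FILE DOES.  `E ∕ F` number fields, `δ ∈ E` with `δ² = m₀` for an algebraic INTEGER `m₀ ∈ 𝓞 F`, `v` a finite place of `F`, `w ∣ v`.
* §1 (a GLOBAL INTEGRAL representative of a local class): `𝓞 F` is dense in `𝒪_v` — every `d ∈ F_v` with `|d|_v ≤ 1`, `d ≠ 0`, has `m₀ ∈ 𝓞 F` with `|m₀ − d|_v < |d|_v`
  (`exists_coe_ringOfIntegers_valued_sub_lt`; ★ S-arithmetic strong approximation `denseRange_algebraMap_sInteger_pi` with `S = {v}` + Mathlib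
  `mem_integers_of_valuation_le_one`); with `|2|_v = 1` Hensel makes `d⁻¹ m₀` a square (`isSquare_inv_mul_of_valued_sub_lt`), so a local UNIT class `d` has an integral
  representative `m₀ ∈ 𝓞 F ∖ 𝔭_v` (`exists_ringOfIntegers_not_mem_isSquare_inv_mul`), non-square in `F_v` when `d` is (`exists_ringOfIntegers_not_mem_isSquare_inv_mul_not_isSquare`).
* §2 (UNRAMIFIED): if `m₀ ∉ 𝔭_v` and `2 ∉ 𝔭_v` then `v` is unramified in `E = F(δ)`: **`isUnramifiedAt_of_sq_eq_of_not_mem`** (`Algebra.IsUnramifiedAt (𝓞 F) 𝔓_w`) and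
  **`isUnramifiedIn_of_sq_eq_of_not_mem`** (`Algebra.IsUnramifiedIn (𝓞 E) 𝔭_v`, the `hv` binder of the tree's inert-place package).  Proof by the DIFFERENT: `δ` is integral with
  `minpoly_{𝓞 F} δ = X² − m₀` (`minpoly_eq_X_sq_sub_C`, `minpoly_ringOfIntegers_eq_X_sq_sub_C`; `F(δ) = E` by `adjoin_eq_top_of_not_mem_range`, the subalgebra lattice of a
  quadratic extension being `{⊥, ⊤}`), so `2δ = f′(δ) ∈ 𝔇(𝓞 E ∕ 𝓞 F)` (Mathlib `aeval_derivative_mem_differentIdeal`, `two_mul_mem_differentIdeal`); if `𝔓_w ∣ 𝔇` (Mathlib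
  `not_dvd_differentIdeal_iff`: ⟺ ramified) then `(2δ)² = 4m₀ ∈ 𝔓_w ∩ 𝓞 F = 𝔭_v`, contradicting `2, m₀ ∉ 𝔭_v`.
* §3 (the INERT-PLACE CURRENCY): if moreover `m₀` is NOT a square in `F_v` then `v` is non-split (★ (QP)), every `σ ∈ Aut(E∕F)` fixes `w`, and with the involution `σ`
  (`σ δ = −δ`, `δ ≠ 0`): **`σ ≠ 1 ∧ Algebra.IsUnramifiedIn (𝓞 E) v.asIdeal ∧ σ • w = w`** (`inertPlace_currency_of_sq_eq_unit`) — literally the binders `(hc, hv, hw)` of ★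
  `natCard_residueField_eq_sq_of_inert` (`#𝓀_w = q_v²`), ★ `residueHom_galAdicCompletionMap_eq_pow` (`σ̄_w = Frob_q`), ★ `exists_mul_galAdicCompletionMap_eq_of_inert` (unit norms),
  ★ `Liu2021.…ramificationIdx_inertiaDeg_dichotomy_of_smul_eq` (`e = 1`, `f = 2`).
* §4 (from a LOCAL non-square unit to the GLOBAL model): `two_not_mem_iff_valued_two_eq_one` (`2 ∉ 𝔭_v ⟺ |2|_v = 1`) and the end-to-end existence
  `exists_ringOfIntegers_not_mem_isSquare_inv_mul_not_isSquare`: for `|2|_v = 1` and a non-square unit `d ∈ 𝒪_v^×` there is `m₀ ∈ 𝓞 F ∖ 𝔭_v`, `d⁻¹ m₀ ∈ (F_v^×)²`, `m₀ ∉ (F_v)²` —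
  so `E := F(√m₀) = AdjoinRoot (X² − C m₀)` (★ (QM)) is inert at `v` with `E_w = F_v(√d)` (★ (Q2)), and §3 applies.

## References
* [Neukirch1999] J. Neukirch, *Algebraic Number Theory*, Grundlehren 322, Springer (1999): Ch. III §2 Thm. (2.6) (`𝔓` ramified ⟺ `𝔓 ∣ 𝔇`), (2.4)–(2.5) (`f′(α) ∈ 𝔇`),
  Ch. II §8 (`e`, `f`), Ch. II (3.4)∕(5.7) (approximation, Hensel).
* [SerreLocalFields1979] J.-P. Serre, *Local Fields*, GTM 67 (1979): Ch. III §6 (different and discriminant; unramified ⟺ `𝔓 ∤ 𝔇`), Ch. I §6.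
* [CasselsFrohlich1967] J. W. S. Cassels, A. Fröhlich (eds.), *Algebraic Number Theory* (1967): Ch. II §15 (strong approximation), Ch. I §5.
-/

set_option autoImplicit false

noncomputable section

open NumberField IsDedekindDomain Polynomial Topology
open Literature.NumberTheory.Automorphic Literature.NumberTheory.Automorphic.UnitaryGroup

namespace Literature.NumberTheory.NumberFields


/-! ## §1 A GLOBAL INTEGRAL representative of a local integral class -/

section Integral

variable {F : Type} [Field F] [NumberField F] (v : HeightOneSpectrum (𝓞 F))

/-- **`𝓞 F` is dense in `𝒪_v`**: every `d ∈ F_v` with `d ≠ 0`, `|d|_v ≤ 1` has an algebraic INTEGER `m₀ ∈ 𝓞 F` with `|m₀ − d|_v < |d|_v` (so `|m₀|_v = |d|_v` and `m₀ ∕ d ≡ 1 mod 𝔪_v`).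
Strong approximation with the excluded set `∞ ∪ {v}` (★ `denseRange_algebraMap_sInteger_pi`, `S = {v}`): an `{v}`-integer close to `d` is integral at `v` too, hence in `𝓞 F`
(Mathlib `HeightOneSpectrum.mem_integers_of_valuation_le_one`). [cite: CasselsFrohlich1967, Ch. II §15] [cite: Neukirch1999, Ch. II (3.4)] -/
theorem exists_coe_ringOfIntegers_valued_sub_lt {d : v.adicCompletion F} (hd : d ≠ 0) (hd1 : Valued.v d ≤ 1) :
    ∃ m₀ : 𝓞 F, Valued.v (((m₀ : F) : v.adicCompletion F) - d) < Valued.v d := by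
  classical
  let S : Set (HeightOneSpectrum (𝓞 F)) := {v}
  let v₀ : S := ⟨v, Set.mem_singleton v⟩
  let p : ∀ v' : S, v'.1.adicCompletion F := Function.update (fun v' => 0) v₀ d
  have hp : p v₀ = d := by simp only [p, Function.update_self]
  have hnhds : {g : ∀ v' : S, v'.1.adicCompletion F | Valued.v (g v₀ - d) < Valued.v d} ∈ 𝓝 p := by
    have hball : {y : v.adicCompletion F | Valued.v (y - d) < Valued.v d} ∈ 𝓝 (p v₀) := by
      rw [hp]; exact ball_mem_nhds v d d (by simpa using hd)
    exact (continuous_apply v₀).continuousAt.preimage_mem_nhds hball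
  obtain ⟨g, hgU, ⟨x, rfl⟩⟩ := mem_closure_iff_nhds.1 (denseRange_algebraMap_sInteger_pi (𝓞 F) F S p) _ hnhds
  have hgU' : Valued.v (((x : F) : v.adicCompletion F) - d) < Valued.v d := hgU
  have hxv : Valued.v ((x : F) : v.adicCompletion F) = Valued.v d := Valuation.map_eq_of_sub_lt _ hgU'
  have hint : ∀ w : HeightOneSpectrum (𝓞 F), w.valuation F (x : F) ≤ 1 := by
    intro w
    rw [← HeightOneSpectrum.valuedAdicCompletion_eq_valuation', ← HeightOneSpectrum.mem_adicCompletionIntegers]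
    by_cases hw : w = v
    · subst hw; rw [HeightOneSpectrum.mem_adicCompletionIntegers, hxv]; exact hd1
    · exact (mem_integer_iff_forall_coe_mem_adicCompletionIntegers (𝓞 F) F S (x : F)).1 x.2 w hw
  obtain ⟨m₀, hm₀⟩ := HeightOneSpectrum.mem_integers_of_valuation_le_one F (x : F) hint
  refine ⟨m₀, ?_⟩
  have : ((m₀ : F) : v.adicCompletion F) = ((x : F) : v.adicCompletion F) := by rw [← hm₀]
  rw [this]; exact hgU'

/-- **Hensel for square classes**: if `|2|_v = 1`, `d ≠ 0` and `|x − d|_v < |d|_v` then `d⁻¹ x ∈ 1 + 𝔪_v` is a square in `F_v` (★ `exists_eq_pow_of_valuation_sub_one_lt`).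
[cite: Neukirch1999, Ch. II (5.7)] [cite: SerreLocalFields1979, Ch. I §6] -/
theorem isSquare_inv_mul_of_valued_sub_lt (h2 : Valued.v (2 : v.adicCompletion F) = 1) {d x : v.adicCompletion F} (hd : d ≠ 0)
    (hx : Valued.v (x - d) < Valued.v d) : IsSquare (d⁻¹ * x) := by
  have hvd : Valued.v d ≠ 0 := by simpa using hd
  set y : v.adicCompletion F := d⁻¹ * x with hy
  have hy1 : Valued.v (y - 1) < 1 := by
    have : y - 1 = d⁻¹ * (x - d) := by rw [hy, mul_sub, inv_mul_cancel₀ hd]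
    rw [this, map_mul, map_inv₀]
    calc (Valued.v d)⁻¹ * Valued.v (x - d) < (Valued.v d)⁻¹ * Valued.v d := mul_lt_mul_of_pos_left hx (inv_pos.2 (zero_lt_iff.2 hvd))
      _ = 1 := inv_mul_cancel₀ hvd
  have heqv : (Valued.v : Valuation (v.adicCompletion F) _).IsEquiv (ValuativeRel.valuation (v.adicCompletion F)) := ValuativeRel.isEquiv _ _
  have h2' : ValuativeRel.valuation (v.adicCompletion F) ((2 : ℕ) : v.adicCompletion F) = 1 := by
    rw [← heqv.eq_one_iff_eq_one]; exact_mod_cast h2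
  have hy1' : ValuativeRel.valuation (v.adicCompletion F) (y - 1) < 1 := by rwa [← heqv.lt_one_iff_lt_one]
  obtain ⟨t, ht⟩ := Literature.NumberTheory.GaloisCohomology.exists_eq_pow_of_valuation_sub_one_lt (v.adicCompletion F) 2 h2' hy1'
  exact ⟨t, by rw [ht, sq]⟩

/-- `|m₀|_v = 1 ⟺ m₀ ∉ 𝔭_v` for `m₀ ∈ 𝓞 F` (Mathlib `valuedAdicCompletion_eq_valuation'`, `valuation_of_algebraMap`, `intValuation_eq_one_iff`). [cite: Neukirch1999, Ch. II §8] -/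
theorem valued_coe_eq_one_iff_not_mem (m₀ : 𝓞 F) : Valued.v (((m₀ : F) : v.adicCompletion F)) = 1 ↔ m₀ ∉ v.asIdeal := by
  rw [HeightOneSpectrum.valuedAdicCompletion_eq_valuation', show (m₀ : F) = algebraMap (𝓞 F) F m₀ from rfl, HeightOneSpectrum.valuation_of_algebraMap,
    HeightOneSpectrum.intValuation_eq_one_iff]

/-- **A local UNIT square class has a global INTEGRAL representative prime to `v`**: for `|2|_v = 1` and `|d|_v = 1` there is `m₀ ∈ 𝓞 F`, `m₀ ∉ 𝔭_v`, with `d⁻¹ m₀` a square in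
`F_v` (§1 density + Hensel). [cite: CasselsFrohlich1967, Ch. II §15] [cite: Neukirch1999, Ch. II (5.7)] -/
theorem exists_ringOfIntegers_not_mem_isSquare_inv_mul (h2 : Valued.v (2 : v.adicCompletion F) = 1) {d : v.adicCompletion F} (hd : Valued.v d = 1) :
    ∃ m₀ : 𝓞 F, m₀ ∉ v.asIdeal ∧ IsSquare (d⁻¹ * ((m₀ : F) : v.adicCompletion F)) := by
  have hd0 : d ≠ 0 := by intro h0; rw [h0, map_zero] at hd; exact zero_ne_one hd
  obtain ⟨m₀, hm₀⟩ := exists_coe_ringOfIntegers_valued_sub_lt v hd0 hd.le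
  refine ⟨m₀, ?_, isSquare_inv_mul_of_valued_sub_lt v h2 hd0 hm₀⟩
  rw [← valued_coe_eq_one_iff_not_mem v m₀, Valuation.map_eq_of_sub_lt _ hm₀, hd]

end Integral

/-! ## §2 `E = F(√m₀)` with `m₀` a `v`-UNIT and `v ∤ 2` is UNRAMIFIED at `v` -/

section Unramified

variable {F : Type} (E : Type) [Field F] [NumberField F] [Field E] [NumberField E] [Algebra F E]

omit [NumberField F] [NumberField E] in
/-- If `δ² = m` with `δ ∉ F` then `m` is not a square in `F` (`m = a²` would give `(δ − a)(δ + a) = 0`). [cite: Neukirch1999, Ch. II §8] -/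
theorem not_isSquare_of_sq_eq_of_not_mem_range {δ : E} {m : F} (hm : algebraMap F E m = δ ^ 2) (hδF : δ ∉ (algebraMap F E).range) :
    ¬ IsSquare m := by
  rintro ⟨a, rfl⟩
  have h : (δ - algebraMap F E a) * (δ + algebraMap F E a) = 0 := by
    have : δ ^ 2 = algebraMap F E a * algebraMap F E a := by rw [← map_mul, hm]
    linear_combination this
  rcases mul_eq_zero.1 h with h | h
  · exact hδF ⟨a, (sub_eq_zero.1 h).symm⟩
  · exact hδF ⟨-a, by rw [map_neg]; exact (neg_eq_of_add_eq_zero_left h)⟩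

omit [NumberField F] [NumberField E] in
/-- **`minpoly_F δ = X² − m`** for `δ ∉ F` with `δ² = m ∈ F` (★ (QM) `irreducible_X_sq_sub_C_of_not_isSquare` + Mathlib `minpoly.eq_of_irreducible_of_monic`). [cite: Neukirch1999, Ch. II §8] -/
theorem minpoly_eq_X_sq_sub_C {δ : E} {m : F} (hm : algebraMap F E m = δ ^ 2) (hδF : δ ∉ (algebraMap F E).range) :
    minpoly F δ = X ^ 2 - C m := by
  have hirr : Irreducible (X ^ 2 - C m : F[X]) := irreducible_X_sq_sub_C_of_not_isSquare m (not_isSquare_of_sq_eq_of_not_mem_range E hm hδF)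
  refine (minpoly.eq_of_irreducible_of_monic hirr ?_ (monic_X_pow_sub_C m two_ne_zero)).symm
  simp only [map_sub, map_pow, aeval_X, aeval_C, hm, sub_self]

omit [NumberField F] [NumberField E] in
/-- **`F[δ] = E`** for `δ ∉ F` in a quadratic extension: the subalgebras of a prime-degree extension are `⊥` and `⊤` (Mathlib `Subalgebra.isSimpleOrder_of_finrank_prime`).
[cite: Neukirch1999, Ch. II §8] -/
theorem adjoin_eq_top_of_not_mem_range [Algebra.IsQuadraticExtension F E] {δ : E} (hδF : δ ∉ (algebraMap F E).range) :
    Algebra.adjoin F {δ} = ⊤ := by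
  haveI := Subalgebra.isSimpleOrder_of_finrank_prime F E (by rw [Algebra.IsQuadraticExtension.finrank_eq_two F E]; exact Nat.prime_two)
  rcases IsSimpleOrder.eq_bot_or_eq_top (Algebra.adjoin F {δ}) with h | h
  · exact absurd (h ▸ Algebra.subset_adjoin (Set.mem_singleton δ) : δ ∈ (⊥ : Subalgebra F E)) (by rwa [Algebra.mem_bot])
  · exact h

omit [NumberField F] [NumberField E] in
/-- `δ` with `δ² = m₀ ∈ 𝓞 F` is an algebraic integer (root of the monic `X² − m₀ ∈ 𝓞 F[X]`, Mathlib `isIntegral_trans`). [cite: Neukirch1999, Ch. I §2] -/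
theorem isIntegral_int_of_sq_eq {δ : E} (m₀ : 𝓞 F) (hm : algebraMap F E m₀ = δ ^ 2) : IsIntegral ℤ δ := by
  have hF : IsIntegral (𝓞 F) δ := by
    refine ⟨X ^ 2 - C m₀, monic_X_pow_sub_C m₀ two_ne_zero, ?_⟩
    simp only [eval₂_sub, eval₂_X_pow, eval₂_C, ← hm, sub_eq_zero]; rfl
  exact isIntegral_trans δ hF

omit [NumberField E] in
/-- **`minpoly_{𝓞 F} δ = X² − m₀`** for `δ ∈ 𝓞 E`, `δ ∉ F`, `δ² = m₀ ∈ 𝓞 F` (`𝓞 F` integrally closed: Mathlib `minpoly.isIntegrallyClosed_eq_field_fractions` + `minpoly_eq_X_sq_sub_C`).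
[cite: Neukirch1999, Ch. I §2] -/
theorem minpoly_ringOfIntegers_eq_X_sq_sub_C (δ₀ : 𝓞 E) (m₀ : 𝓞 F) (hm : algebraMap F E m₀ = (δ₀ : E) ^ 2)
    (hδF : (δ₀ : E) ∉ (algebraMap F E).range) : minpoly (𝓞 F) δ₀ = X ^ 2 - C m₀ := by
  have hint : IsIntegral (𝓞 F) δ₀ := Algebra.IsIntegral.isIntegral δ₀
  have h := minpoly.isIntegrallyClosed_eq_field_fractions F E hint
  rw [show algebraMap (𝓞 E) E δ₀ = (δ₀ : E) from rfl, minpoly_eq_X_sq_sub_C E hm hδF] at h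
  apply Polynomial.map_injective (algebraMap (𝓞 F) F) (FaithfulSMul.algebraMap_injective (𝓞 F) F)
  rw [← h]
  simp only [Polynomial.map_sub, Polynomial.map_pow, map_X, map_C]

/-- **`2δ ∈ 𝔇(𝓞 E ∕ 𝓞 F)`**: the different contains `f′(δ)` for the integral generator `δ` of `E = F(δ)`, `f = minpoly_{𝓞 F} δ = X² − m₀` (Mathlib `aeval_derivative_mem_differentIdeal`).
[cite: Neukirch1999, Ch. III §2 (2.4)–(2.5)] [cite: SerreLocalFields1979, Ch. III §6] -/
theorem two_mul_mem_differentIdeal [Algebra.IsQuadraticExtension F E] (δ₀ : 𝓞 E) (m₀ : 𝓞 F) (hm : algebraMap F E m₀ = (δ₀ : E) ^ 2)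
    (hδF : (δ₀ : E) ∉ (algebraMap F E).range) : 2 * δ₀ ∈ differentIdeal (𝓞 F) (𝓞 E) := by
  have h := aeval_derivative_mem_differentIdeal (𝓞 F) F E δ₀ (adjoin_eq_top_of_not_mem_range E hδF)
  rw [minpoly_ringOfIntegers_eq_X_sq_sub_C E δ₀ m₀ hm hδF] at h
  rw [← one_add_one_eq_two]
  simpa [derivative_sub, derivative_X_pow, derivative_C] using h

/-- **`E = F(√m₀)` IS UNRAMIFIED AT `w ∣ v` WHEN `m₀, 2 ∉ 𝔭_v`**: `Algebra.IsUnramifiedAt (𝓞 F) 𝔓_w`.  By Mathlib `not_dvd_differentIdeal_iff` it suffices that `𝔓_w ∤ 𝔇`; but `2δ ∈ 𝔇`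
(`two_mul_mem_differentIdeal`), so `𝔓_w ∣ 𝔇` would give `(2δ)² = 4m₀ ∈ 𝔓_w ∩ 𝓞 F = 𝔭_v`, i.e. `2 ∈ 𝔭_v` or `m₀ ∈ 𝔭_v`. (The separability instance on the abstract fraction fields is
transported from `E ∕ F` as in ★ `UnramifiedDiscriminant`.) [cite: Neukirch1999, Ch. III §2 Thm. (2.6)] [cite: SerreLocalFields1979, Ch. III §6] -/
theorem isUnramifiedAt_of_sq_eq_of_not_mem [Algebra.IsQuadraticExtension F E] (v : HeightOneSpectrum (𝓞 F)) (w : PlacesOver E v) {δ : E} (m₀ : 𝓞 F)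
    (hm : algebraMap F E m₀ = δ ^ 2) (hδF : δ ∉ (algebraMap F E).range) (hm₀ : m₀ ∉ v.asIdeal) (h2 : (2 : 𝓞 F) ∉ v.asIdeal) :
    Algebra.IsUnramifiedAt (𝓞 F) w.1.asIdeal := by
  let δ₀ : 𝓞 E := ⟨δ, isIntegral_int_of_sq_eq E m₀ hm⟩
  have hδ₀ : (δ₀ : E) = δ := rfl
  have hD : 2 * δ₀ ∈ differentIdeal (𝓞 F) (𝓞 E) := two_mul_mem_differentIdeal E δ₀ m₀ (hδ₀ ▸ hm) (hδ₀ ▸ hδF)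
  -- the compatible algebra structure on the abstract fraction fields (Mathlib keeps it non-instance) and separability (char. 0)
  letI : Algebra (FractionRing (𝓞 F)) (FractionRing (𝓞 E)) := FractionRing.liftAlgebra _ _
  haveI : Algebra.IsSeparable (FractionRing (𝓞 F)) (FractionRing (𝓞 E)) := by
    refine Algebra.IsSeparable.of_equiv_equiv (FractionRing.algEquiv (𝓞 F) F).symm.toRingEquiv
      (FractionRing.algEquiv (𝓞 E) E).symm.toRingEquiv ?_
    ext x
    exact IsFractionRing.algEquiv_commutes (FractionRing.algEquiv (𝓞 F) F).symm (FractionRing.algEquiv (𝓞 E) E).symm _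
  refine not_dvd_differentIdeal_iff.1 fun hdvd => ?_
  have h2δ : 2 * δ₀ ∈ w.1.asIdeal := (Ideal.le_of_dvd hdvd) hD
  -- square it: `4 m₀ ∈ 𝔓_w ∩ 𝓞 F = 𝔭_v`
  have h4m : algebraMap (𝓞 F) (𝓞 E) (2 * 2 * m₀) ∈ w.1.asIdeal := by
    have heq : algebraMap (𝓞 F) (𝓞 E) (2 * 2 * m₀) = (2 * δ₀) * (2 * δ₀) := by
      apply RingOfIntegers.ext
      have e1 : ((algebraMap (𝓞 F) (𝓞 E) (2 * 2 * m₀) : 𝓞 E) : E) = 2 * 2 * δ ^ 2 := by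
        rw [RingOfIntegers.coe_eq_algebraMap, ← IsScalarTower.algebraMap_apply, IsScalarTower.algebraMap_apply (𝓞 F) F E, ← hm]
        simp only [map_mul, map_ofNat]
      have e2 : (((2 * δ₀) * (2 * δ₀) : 𝓞 E) : E) = 2 * δ * (2 * δ) := by
        simp only [map_mul, map_ofNat, δ₀, RingOfIntegers.map_mk]
      rw [e1, e2]; ring
    rw [heq]; exact Ideal.mul_mem_left _ _ h2δ
  have hva : v.asIdeal = Ideal.comap (algebraMap (𝓞 F) (𝓞 E)) w.1.asIdeal := (PlacesOver.liesOver w).over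
  have hv : (2 * 2 * m₀ : 𝓞 F) ∈ v.asIdeal := by rw [hva, Ideal.mem_comap]; exact h4m
  rcases v.isPrime.mem_or_mem hv with h | h
  · rcases v.isPrime.mem_or_mem h with h | h <;> exact h2 h
  · exact hm₀ h

/-- **`v` IS UNRAMIFIED IN `E = F(√m₀)` WHEN `m₀, 2 ∉ 𝔭_v`**: `Algebra.IsUnramifiedIn (𝓞 E) v.asIdeal` — the `hv` binder of the tree's inert-place package (★ `natCard_residueField_eq_sq_of_inert`,
★ `residueHom_galAdicCompletionMap_eq_pow`, ★ `exists_mul_galAdicCompletionMap_eq_of_inert`): every prime `𝔓 ∣ 𝔭_v` of `𝓞 E` is a place `w ∣ v`, unramified by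
`isUnramifiedAt_of_sq_eq_of_not_mem`. [cite: Neukirch1999, Ch. III §2 Thm. (2.6)] [cite: SerreLocalFields1979, Ch. III §6] -/
theorem isUnramifiedIn_of_sq_eq_of_not_mem [Algebra.IsQuadraticExtension F E] (v : HeightOneSpectrum (𝓞 F)) {δ : E} (m₀ : 𝓞 F)
    (hm : algebraMap F E m₀ = δ ^ 2) (hδF : δ ∉ (algebraMap F E).range) (hm₀ : m₀ ∉ v.asIdeal) (h2 : (2 : 𝓞 F) ∉ v.asIdeal) :
    Algebra.IsUnramifiedIn (𝓞 E) v.asIdeal := by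
  intro P hP hlo
  have hPbot : P ≠ ⊥ := Ideal.ne_bot_of_liesOver_of_ne_bot v.ne_bot P
  let w : PlacesOver E v := ⟨⟨P, hP, hPbot⟩, HeightOneSpectrum.ext hlo.over.symm⟩
  exact isUnramifiedAt_of_sq_eq_of_not_mem E v w m₀ hm hδF hm₀ h2

end Unramified


/-! ## §3 The INERT-place currency: `m₀` a `v`-unit, `2 ∉ 𝔭_v`, `m₀` a non-square in `F_v` -/

section Inert

variable {F : Type} (E : Type) [Field F] [NumberField F] [Field E] [NumberField E] [Algebra F E]

omit [NumberField F] [NumberField E] in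
/-- An element negated by an `F`-automorphism is not in `F` unless it is `0`: `σ δ = −δ`, `δ ≠ 0` ⇒ `δ ∉ F` (characteristic `≠ 2`). [cite: Neukirch1999, Ch. II §8] -/
theorem not_mem_range_of_apply_eq_neg [CharZero E] (σ : E ≃ₐ[F] E) {δ : E} (hσδ : σ δ = -δ) (hδ : δ ≠ 0) : δ ∉ (algebraMap F E).range := by
  rintro ⟨a, rfl⟩
  rw [AlgEquiv.commutes] at hσδ
  exact hδ (self_eq_neg.1 hσδ)

variable [Algebra.IsQuadraticExtension F E]

/-- **THE INERT-PLACE CURRENCY FROM A UNIT SQUARE CLASS.**  For the quadratic field `E ∋ δ`, `δ² = m₀ ∈ 𝓞 F`, involution `σ` (`σ δ = −δ`, `δ ≠ 0`) and a finite place `v` with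
`m₀ ∉ 𝔭_v`, `2 ∉ 𝔭_v` and `m₀` NOT a square in `F_v`: every `w ∣ v` satisfies `σ ≠ 1 ∧ Algebra.IsUnramifiedIn (𝓞 E) 𝔭_v ∧ σ • w = w` — literally the binders `(hc, hv, hw)` of ★
`natCard_residueField_eq_sq_of_inert` (`#𝓀_w = q_v²`), ★ `residueHom_galAdicCompletionMap_eq_pow` (`σ̄_w = x ↦ x^{q_v}`), ★ `exists_mul_galAdicCompletionMap_eq_of_inert` (units are norms) and ★
`ramificationIdx_inertiaDeg_dichotomy_of_smul_eq` (`e(w|v) = 1`, `f(w|v) = 2`); `v` is non-split (★ (QP)). [cite: Neukirch1999, Ch. III §2 Thm. (2.6)] [cite: Neukirch1999, Ch. II (8.2)–(8.3)] -/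
theorem inertPlace_currency_of_sq_eq_unit (v : HeightOneSpectrum (𝓞 F)) (σ : E ≃ₐ[F] E) {δ : E} (hσδ : σ δ = -δ) (hδ : δ ≠ 0) (m₀ : 𝓞 F)
    (hm : algebraMap F E m₀ = δ ^ 2) (hm₀ : m₀ ∉ v.asIdeal) (h2 : (2 : 𝓞 F) ∉ v.asIdeal) (hns : ¬ IsSquare (((m₀ : F) : v.adicCompletion F))) (w : PlacesOver E v) :
    σ ≠ 1 ∧ Algebra.IsUnramifiedIn (𝓞 E) v.asIdeal ∧ σ • w.1 = w.1 :=
  haveI := subsingleton_placesOver_of_not_isSquare E v σ hσδ hδ hm hns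
  ⟨algEquiv_ne_one_of_apply_eq_neg E σ hσδ hδ, isUnramifiedIn_of_sq_eq_of_not_mem E v m₀ hm (not_mem_range_of_apply_eq_neg E σ hσδ hδ) hm₀ h2,
    smul_placesOver_eq_of_subsingleton E v σ w⟩

/-- … together with NON-SPLITNESS: exactly one place of `E` lies over `v` (★ (QP) `subsingleton_placesOver_of_not_isSquare`; `Nonempty` always). [cite: Neukirch1999, Ch. II (8.2)–(8.3)] -/
theorem nonempty_and_subsingleton_placesOver_of_sq_eq_unit (v : HeightOneSpectrum (𝓞 F)) (σ : E ≃ₐ[F] E) {δ : E} (hσδ : σ δ = -δ) (hδ : δ ≠ 0) (m₀ : 𝓞 F)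
    (hm : algebraMap F E m₀ = δ ^ 2) (hns : ¬ IsSquare (((m₀ : F) : v.adicCompletion F))) :
    Nonempty (PlacesOver E v) ∧ Subsingleton (PlacesOver E v) :=
  ⟨inferInstance, subsingleton_placesOver_of_not_isSquare E v σ hσδ hδ hm hns⟩

end Inert

/-! ## §4 From a LOCAL non-square unit `d ∈ 𝒪_v^×` (`v ∤ 2`) to the GLOBAL integral datum `m₀` -/

section Global

variable {F : Type} [Field F] [NumberField F] (v : HeightOneSpectrum (𝓞 F))

/-- `2 ∉ 𝔭_v ⟺ |2|_v = 1` (the two spellings of «`v ∤ 2`» used by the consumers). [cite: Neukirch1999, Ch. II §8] -/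
theorem two_not_mem_iff_valued_two_eq_one : (2 : 𝓞 F) ∉ v.asIdeal ↔ Valued.v (2 : v.adicCompletion F) = 1 := by
  rw [← valued_coe_eq_one_iff_not_mem v 2]
  have h : (((2 : 𝓞 F) : F) : v.adicCompletion F) = 2 := by
    rw [show ((2 : 𝓞 F) : F) = 2 from map_ofNat (algebraMap (𝓞 F) F) 2]
    exact map_ofNat (algebraMap F (v.adicCompletion F)) 2
  rw [h]

/-- **A local non-square UNIT class has a global INTEGRAL, `v`-UNIT, locally NON-SQUARE representative**: for `|2|_v = 1`, `|d|_v = 1`, `d ∉ (F_v)²` there is `m₀ ∈ 𝓞 F` with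
`m₀ ∉ 𝔭_v`, `d⁻¹ m₀ ∈ (F_v^×)²` and `m₀ ∉ (F_v)²` — so `E := F(√m₀)` (`AdjoinRoot (X² − C m₀)`, ★ (QM)) is INERT at `v` (§3) with `E_w = F_v ⊕ F_v √m₀ = F_v(√d)` (★ (Q2)): the unramified
quadratic extension `K₁ = F_v(√d)` IS a completion of a global quadratic field. [cite: CasselsFrohlich1967, Ch. II §15] [cite: Neukirch1999, Ch. II (5.7)] -/
theorem exists_ringOfIntegers_not_mem_isSquare_inv_mul_not_isSquare (h2 : Valued.v (2 : v.adicCompletion F) = 1) {d : v.adicCompletion F} (hd : Valued.v d = 1)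
    (hns : ¬ IsSquare d) :
    ∃ m₀ : 𝓞 F, m₀ ∉ v.asIdeal ∧ IsSquare (d⁻¹ * ((m₀ : F) : v.adicCompletion F)) ∧ ¬ IsSquare (((m₀ : F) : v.adicCompletion F)) := by
  obtain ⟨m₀, hm₀, hsq⟩ := exists_ringOfIntegers_not_mem_isSquare_inv_mul v h2 hd
  refine ⟨m₀, hm₀, hsq, fun hm => hns ?_⟩
  obtain ⟨s, hs⟩ := hsq
  obtain ⟨t, ht⟩ := hm
  have hd0 : d ≠ 0 := by intro h0; rw [h0, map_zero] at hd; exact zero_ne_one hd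
  have hm0' : ((m₀ : F) : v.adicCompletion F) ≠ 0 := by
    intro h0
    have h1 := (valued_coe_eq_one_iff_not_mem v m₀).2 hm₀
    rw [h0, map_zero] at h1
    exact zero_ne_one h1
  have hs0 : s ≠ 0 := by
    rintro rfl
    rw [mul_zero] at hs
    exact mul_ne_zero (inv_ne_zero hd0) hm0' hs
  have hm' : ((m₀ : F) : v.adicCompletion F) = d * (s * s) := by rw [← hs, mul_inv_cancel_left₀ hd0]
  refine ⟨t * s⁻¹, ?_⟩
  have hd' : d = ((m₀ : F) : v.adicCompletion F) * (s * s)⁻¹ := by rw [hm', mul_inv_cancel_right₀ (mul_ne_zero hs0 hs0)]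
  rw [hd', ht]
  field_simp

end Global

end Literature.NumberTheory.NumberFields

end
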